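import Summits.Parity.GeneralizedHardyLittlewood.Theorems.LeeYangFibresCellParityLawFibreInheritanceAux
import HarnessLib

/-!
# Route `LeeYangFibres`, crux `CellParityLaw` (stmt-Parity-14109), line `section-annihilator`:
# the registered stub `stub_fibreInheritance` — fibres of admissible data are admissible on average

Skeleton v18 (lead c5). This file proves `FibreInheritance` (vocabulary file
`LeeYangFibresCellParityLawP2Defs`): for kernel-admissible data `(𝒜, x, η, Λ, w₀, R)` (`2 ≤ x`, `1 ≤ z`,
`0 < η ≤ 1/2`, `0 ≤ R`) there are fibre Type-I bounds `R_p ≥ 0` with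

  `Σ_{z < p ≤ x, p prime} R_p ≤ C (log x) (R + x/z)`

such that for every prime `z < p ≤ x^{1/2}` the fibre `𝒜_p = fibreSeq 𝒜 p` (weights `m ↦ a_{pm}`) is
kernel-admissible at `(x/p, η_p, Λ, w₀, R_p)`, `η_p = η log x / log(x/p)` (so that `(x/p)^{1-η_p} = x^{1-η}/p`).

Proof (pure bookkeeping, [FriedlanderIwaniecPisa1978] §4 / [BombieriAsymptoticSieve1976] §1 style; the tools are in
`LeeYangFibresCellParityLawFibreInheritanceAux`):

* reindexing `n = pm`: `(𝒜_p)_{d'}(y') = A_{pd'}(py')`, `(𝒜_p)(y') = A_p(py')`, so for `p ∤ d'` the fibre's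
  remainder is `r_{pd'}(py') − g(d') r_p(py')` (multiplicativity `g(pd') = g(p) g(d')`);
* `h_d := max_{n ≤ x} |r_d(n)|` dominates `|r_d(y)|` for every `y ≤ x` (the remainder only sees `⌊y⌋`), and
  `Σ_{d ≤ x^{1-η} sqfree} h_d ≤ R` (the strong Type-I bound at the maximising selection);
* moduli `p ∣ d' = p d''` are junk: `|r^{(p)}_{d'}(y')| ≤ #{m ≤ x/p : d' ∣ m} + g(p) g(d'') #{m ≤ x/p}
  ≤ (x/p²)(1/d'' + |A₁| g(d''))`;
* `R_p := Σ_{d' ≤ x^{1-η}/p, sqfree, p ∤ d'} (h_{pd'} + g(d') h_p) + (x/p²) W`,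
  `W = Σ_{d'' ≤ x sqfree} (1/d'' + |A₁| g(d''))`, for `p ≤ x^{1/2}`, and `R_p := 0` beyond;
* summing over `p`: each squarefree `d` is `p d'` for at most `ω(d) ≤ log d/log 2 ≤ 2 log x` primes `p`, so
  `Σ_p Σ_{d'} h_{pd'} ≤ 2 log x · R`; `Σ_{d' ≤ x sqfree} g(d') ≤ ∏_{q ≤ x} (1 + g(q)) ≤ ∏_{q ≤ x} (1 − g(q))⁻¹
  ≤ (log(x+1)/log 2)(1 + L'/log 2) ≤ K log x` (`Ω(1, L')`), `K = 4(1 + 2|L'|)`; `Σ_{d ≤ x} 1/d ≤ 1 + log x`;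
  `Σ_{p > z} 1/p² ≤ 2/(⌊z⌋ + 1) ≤ 2/z`. Altogether `Σ_p R_p ≤ C log x (R + x/z)` with `A₃ = 1`,
  `C = 8 + K + 2|A₁| K`.

References: J. Friedlander, H. Iwaniec, Ann. Sc. Norm. Sup. Pisa (4) 5 (1978) §4 [FriedlanderIwaniecPisa1978];
E. Bombieri, Rend. Accad. Naz. XL (5) 1/2 (1975/76) §1 [BombieriAsymptoticSieve1976].
-/

noncomputable section

open scoped BigOperators Classical
open Finset Literature.NumberTheory.Sieve

namespace Summit.Parity.GeneralizedHardyLittlewood.Cruxes.CellParityLaw.SectionAnnihilator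

namespace FibreInheritanceAux

/-- **The fibre's strong Type-I bound** at level `(x/p)^{1-η_p} = x^{1-η}/p`: coprime moduli through
`r^{(p)}_{d'} = r_{pd'} − g(d') r_p` and a majorant `h` of the truncated remainders, moduli `p ∣ d'` as junk
`≤ (x/p²)(1/d'' + |A₁| g(d''))`. -/
theorem fibre_strongTypeI (A₁ : ℝ) (𝒜 : SieveSequence) {L' x η : ℝ} {p : ℕ} (h : ℕ → ℝ) (hx : 2 ≤ x)
    (hη0 : 0 ≤ η) (hp : p.Prime) (hpx : (p : ℝ) ≤ x ^ (1 / 2 : ℝ))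
    (ha1 : ∀ q : ℕ, 𝒜.a q ≤ 1) (hhle : ∀ (d : ℕ) (y : ℝ), y ≤ x → |𝒜.remainder d y| ≤ h d)
    (hdens : ∀ q : ℕ, q.Prime → 𝒜.density q ≤ A₁ / q) (hdim : HasIwaniecDimension 𝒜.density 1 L') :
    StrongTypeI (fibreSeq 𝒜 p) (x / p) (η * Real.log x / Real.log (x / p))
      (∑ d ∈ ((Finset.Icc 1 ⌊x ^ (1 - η) / (p : ℝ)⌋₊).filter Squarefree).filter (fun d => p.Coprime d),
          (h (p * d) + 𝒜.density d * h p) +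
        x / (p : ℝ) ^ 2 * ∑ d ∈ (Finset.Icc 1 ⌊x⌋₊).filter Squarefree, (1 / (d : ℝ) + |A₁| * 𝒜.density d)) := by
  intro y hy
  -- ranges
  have hx0 : 0 < x := by linarith
  have hx1 : 1 < x := by linarith
  have hp0' : 0 < p := hp.pos
  have hp0 : (0 : ℝ) < p := by exact_mod_cast hp0'
  have hp1 : (1 : ℝ) ≤ p := by exact_mod_cast hp.one_lt.le
  have hsqrt_lt : x ^ (1 / 2 : ℝ) < x := by
    have h' := Real.rpow_lt_rpow_of_exponent_lt hx1 (show (1 / 2 : ℝ) < 1 by norm_num)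
    rwa [Real.rpow_one] at h'
  have hpx' : (p : ℝ) < x := hpx.trans_lt hsqrt_lt
  have hD0 : 0 < x ^ (1 - η) := Real.rpow_pos_of_pos hx0 _
  have hDx : x ^ (1 - η) ≤ x := by
    have h' := Real.rpow_le_rpow_of_exponent_le hx1.le (show 1 - η ≤ 1 by linarith)
    rwa [Real.rpow_one] at h'
  have hpy : ∀ d, (p : ℝ) * y d ≤ x := fun d => (le_div_iff₀' hp0).mp (hy d)
  have hg0 : ∀ q : ℕ, q.Prime → 0 ≤ 𝒜.density q := fun q hq => (hdim.1 q hq).1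
  have hgsf : ∀ d : ℕ, Squarefree d → 0 ≤ 𝒜.density d := fun d hd =>
    𝒜.density_mult.nonneg_of_squarefree hg0 hd
  have hfloor : ∀ d, ((⌊y d⌋₊ : ℕ) : ℝ) ≤ x / p := fun d =>
    (Nat.cast_le.mpr (Nat.floor_le_floor (hy d))).trans (Nat.floor_le (div_nonneg hx0.le hp0.le))
  rw [fibre_level hx0 hp0 hpx']
  set T : Finset ℕ := (Finset.Icc 1 ⌊x ^ (1 - η) / (p : ℝ)⌋₊).filter Squarefree with hT
  rw [← Finset.sum_filter_add_sum_filter_not T (fun d => p.Coprime d)]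
  refine add_le_add (Finset.sum_le_sum fun d hd => ?_) ?_
  · -- coprime moduli
    obtain ⟨hdT, hcop⟩ := Finset.mem_filter.mp hd
    have hsq : Squarefree d := (Finset.mem_filter.mp hdT).2
    rw [fibreSeq_remainder_of_coprime 𝒜 hp0' hcop]
    calc |𝒜.remainder (p * d) (p * y d) - 𝒜.density d * 𝒜.remainder p (p * y d)|
        ≤ |𝒜.remainder (p * d) (p * y d)| + |𝒜.density d * 𝒜.remainder p (p * y d)| := abs_sub _ _
      _ = |𝒜.remainder (p * d) (p * y d)| + 𝒜.density d * |𝒜.remainder p (p * y d)| := by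
          rw [abs_mul, abs_of_nonneg (hgsf d hsq)]
      _ ≤ h (p * d) + 𝒜.density d * h p :=
          add_le_add (hhle _ _ (hpy d)) (mul_le_mul_of_nonneg_left (hhle _ _ (hpy d)) (hgsf d hsq))
  · -- junk moduli `p ∣ d`
    rw [Finset.mul_sum]
    have hdvd : ∀ d ∈ T.filter (fun d => ¬p.Coprime d), p ∣ d := fun d hd =>
      not_not.mp ((Nat.Prime.coprime_iff_not_dvd hp).not.mp (Finset.mem_filter.mp hd).2)
    refine FriedlanderIwaniecPrimes.sum_le_sum_of_injOn_real (fun d => d / p) ?_ ?_ ?_ ?_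
    · intro d₁ h₁ d₂ h₂ he
      have he' : d₁ / p = d₂ / p := he
      calc d₁ = d₁ / p * p := (Nat.div_mul_cancel (hdvd d₁ h₁)).symm
        _ = d₂ / p * p := by rw [he']
        _ = d₂ := Nat.div_mul_cancel (hdvd d₂ h₂)
    · intro d hd
      have hpd := hdvd d hd
      obtain ⟨hdT, -⟩ := Finset.mem_filter.mp hd
      obtain ⟨hdI, hsq⟩ := Finset.mem_filter.mp hdT
      obtain ⟨hd1, hdle⟩ := Finset.mem_Icc.mp hdI
      refine Finset.mem_filter.mpr ⟨Finset.mem_Icc.mpr ⟨?_, ?_⟩, hsq.squarefree_of_dvd (Nat.div_dvd_of_dvd hpd)⟩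
      · exact Nat.div_pos (Nat.le_of_dvd hd1 hpd) hp0'
      · refine (Nat.div_le_self d p).trans (hdle.trans (Nat.floor_le_floor ?_))
        exact (div_le_self hD0.le hp1).trans hDx
    · intro d hd
      have hsq : Squarefree d := (Finset.mem_filter.mp hd).2
      have : 0 ≤ 1 / (d : ℝ) + |A₁| * 𝒜.density d :=
        add_nonneg (by positivity) (mul_nonneg (abs_nonneg _) (hgsf d hsq))
      positivity
    · intro d hd
      have hpd := hdvd d hd
      obtain ⟨hdT, -⟩ := Finset.mem_filter.mp hd
      obtain ⟨hdI, hsq⟩ := Finset.mem_filter.mp hdT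
      obtain ⟨hd1, -⟩ := Finset.mem_Icc.mp hdI
      set d'' : ℕ := d / p with hd''
      have hdeq : d = p * d'' := (Nat.mul_div_cancel' hpd).symm
      have hsq' : p.Coprime d'' ∧ Squarefree p ∧ Squarefree d'' := by
        rw [hdeq] at hsq
        exact Nat.squarefree_mul_iff.mp hsq
      have hd''0 : 0 < d'' := Nat.div_pos (Nat.le_of_dvd hd1 hpd) hp0'
      have hd''0r : (0 : ℝ) < d'' := by exact_mod_cast hd''0
      have hdeqr : (d : ℝ) = (p : ℝ) * d'' := by rw [hdeq]; push_cast; ring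
      -- the remainder of the fibre, crudely
      have hr : (fibreSeq 𝒜 p).remainder d (y d) =
          (fibreSeq 𝒜 p).congrSum d (y d) - 𝒜.density d * (fibreSeq 𝒜 p).size (y d) := rfl
      have hC0 : 0 ≤ (fibreSeq 𝒜 p).congrSum d (y d) := SieveSequence.congrSum_nonneg _ _ _
      have hS0 : 0 ≤ (fibreSeq 𝒜 p).size (y d) := by
        rw [fibreSeq_size]
        exact SieveSequence.congrSum_nonneg _ _ _
      have hgd : 0 ≤ 𝒜.density d := hgsf d hsq
      -- `(𝒜_p)_d(y) ≤ ⌊y⌋/d ≤ (x/p)/d = (x/p²)/d''`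
      have hC : (fibreSeq 𝒜 p).congrSum d (y d) ≤ x / (p : ℝ) ^ 2 * (1 / (d'' : ℝ)) := by
        have h1 := congrSum_le_floor_div (fibreSeq 𝒜 p) (fun q => ha1 (p * q)) d (y d)
        have h2 : (((⌊y d⌋₊ / d : ℕ) : ℕ) : ℝ) ≤ (⌊y d⌋₊ : ℝ) / d := Nat.cast_div_le
        have h3 : (⌊y d⌋₊ : ℝ) / d ≤ x / p / d := div_le_div_of_nonneg_right (hfloor d) (Nat.cast_nonneg d)
        have h4 : x / p / d = x / (p : ℝ) ^ 2 * (1 / (d'' : ℝ)) := by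
          rw [hdeqr]
          field_simp
        linarith
      -- `g(d) (𝒜_p)(y) ≤ (|A₁|/p) g(d'') · (x/p)`
      have hG : 𝒜.density d * (fibreSeq 𝒜 p).size (y d) ≤ x / (p : ℝ) ^ 2 * (|A₁| * 𝒜.density d'') := by
        have hgp : 𝒜.density p ≤ |A₁| / p :=
          (hdens p hp).trans (div_le_div_of_nonneg_right (le_abs_self A₁) hp0.le)
        have hg1 : 𝒜.density d ≤ |A₁| / p * 𝒜.density d'' := by
          rw [hdeq, 𝒜.density_mult.map_mul_of_coprime hsq'.1]
          exact mul_le_mul_of_nonneg_right hgp (hgsf d'' hsq'.2.2)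
        have hs1 : (fibreSeq 𝒜 p).size (y d) ≤ x / p := by
          rw [fibreSeq_size]
          have h1 := congrSum_le_floor_div (fibreSeq 𝒜 p) (fun q => ha1 (p * q)) 1 (y d)
          rw [Nat.div_one] at h1
          exact h1.trans (hfloor d)
        calc 𝒜.density d * (fibreSeq 𝒜 p).size (y d) ≤ |A₁| / p * 𝒜.density d'' * (x / p) :=
              mul_le_mul hg1 hs1 hS0
                (mul_nonneg (div_nonneg (abs_nonneg _) hp0.le) (hgsf d'' hsq'.2.2))
          _ = x / (p : ℝ) ^ 2 * (|A₁| * 𝒜.density d'') := by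
              field_simp
      rw [hr]
      calc |(fibreSeq 𝒜 p).congrSum d (y d) - 𝒜.density d * (fibreSeq 𝒜 p).size (y d)|
          ≤ |(fibreSeq 𝒜 p).congrSum d (y d)| + |𝒜.density d * (fibreSeq 𝒜 p).size (y d)| :=
            abs_sub _ _
        _ = (fibreSeq 𝒜 p).congrSum d (y d) + 𝒜.density d * (fibreSeq 𝒜 p).size (y d) := by
            rw [abs_of_nonneg hC0, abs_of_nonneg (mul_nonneg hgd hS0)]
        _ ≤ x / (p : ℝ) ^ 2 * (1 / (d'' : ℝ)) + x / (p : ℝ) ^ 2 * (|A₁| * 𝒜.density d'') :=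
            add_le_add hC hG
        _ = x / (p : ℝ) ^ 2 * (1 / (d'' : ℝ) + |A₁| * 𝒜.density d'') := by ring

/-- **Summing the fibre bounds over the primes `z < p ≤ x^{1/2}`**: for a majorant `h ≥ 0` with
`Σ_{d ≤ x^{1-η} sqfree} h_d ≤ R`, `Σ_p R_p ≤ (2 + K) log x · R + 2 (3 + |A₁| K) log x · x/z`. -/
theorem sum_fibreBound_le (A₁ L' : ℝ) (𝒜 : SieveSequence) {x z η R : ℝ} (h : ℕ → ℝ) (hx : 2 ≤ x)
    (hz : 1 ≤ z) (hη0 : 0 ≤ η) (hη2 : η ≤ 1 / 2) (hdim : HasIwaniecDimension 𝒜.density 1 L')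
    (hh0 : ∀ d, 0 ≤ h d) (hhsum : ∑ d ∈ (Finset.Icc 1 ⌊x ^ (1 - η)⌋₊).filter Squarefree, h d ≤ R) :
    ∑ p ∈ ((Finset.Ioc 0 ⌊x⌋₊).filter (fun p : ℕ => p.Prime ∧ z < (p : ℝ))).filter
        (fun p : ℕ => (p : ℝ) ≤ x ^ (1 / 2 : ℝ)),
      (∑ d ∈ ((Finset.Icc 1 ⌊x ^ (1 - η) / (p : ℝ)⌋₊).filter Squarefree).filter (fun d => p.Coprime d),
            (h (p * d) + 𝒜.density d * h p) +
          x / (p : ℝ) ^ 2 * ∑ d ∈ (Finset.Icc 1 ⌊x⌋₊).filter Squarefree, (1 / (d : ℝ) + |A₁| * 𝒜.density d)) ≤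
      (2 + 4 * (1 + 2 * |L'|)) * Real.log x * R +
        2 * (3 + |A₁| * (4 * (1 + 2 * |L'|))) * Real.log x * (x / z) := by
  set K : ℝ := 4 * (1 + 2 * |L'|) with hK
  set W : ℝ := ∑ d ∈ (Finset.Icc 1 ⌊x⌋₊).filter Squarefree, (1 / (d : ℝ) + |A₁| * 𝒜.density d) with hW
  set P' : Finset ℕ := ((Finset.Ioc 0 ⌊x⌋₊).filter (fun p : ℕ => p.Prime ∧ z < (p : ℝ))).filter
      (fun p : ℕ => (p : ℝ) ≤ x ^ (1 / 2 : ℝ)) with hP'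
  set S : Finset ℕ := (Finset.Icc 1 ⌊x ^ (1 - η)⌋₊).filter Squarefree with hS
  set Sx : Finset ℕ := (Finset.Icc 1 ⌊x⌋₊).filter Squarefree with hSx
  -- ranges
  have hx0 : 0 < x := by linarith
  have hx1 : 1 < x := by linarith
  have hz0 : 0 < z := by linarith
  have hK0 : 0 ≤ K := by positivity
  have hlog2 : (1 : ℝ) / 2 < Real.log 2 := by linarith [Real.log_two_gt_d9]
  have hlog2pos : 0 < Real.log 2 := by linarith
  have hlogx : Real.log 2 ≤ Real.log x := Real.log_le_log two_pos hx
  have hlx0 : 0 < Real.log x := by linarith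
  have hD0 : 0 < x ^ (1 - η) := Real.rpow_pos_of_pos hx0 _
  have hDx : x ^ (1 - η) ≤ x := by
    have h' := Real.rpow_le_rpow_of_exponent_le hx1.le (show 1 - η ≤ 1 by linarith)
    rwa [Real.rpow_one] at h'
  have hsqrtD : x ^ (1 / 2 : ℝ) ≤ x ^ (1 - η) :=
    Real.rpow_le_rpow_of_exponent_le hx1.le (by linarith)
  have hP'mem : ∀ p ∈ P', p.Prime ∧ z < (p : ℝ) ∧ (p : ℝ) ≤ x ^ (1 / 2 : ℝ) ∧ p ≤ ⌊x⌋₊ := by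
    intro p hp
    obtain ⟨hp1, hpx⟩ := Finset.mem_filter.mp hp
    obtain ⟨hp2, hpp, hzp⟩ := Finset.mem_filter.mp hp1
    exact ⟨hpp, hzp, hpx, (Finset.mem_Ioc.mp hp2).2⟩
  have hR0 : 0 ≤ R := (Finset.sum_nonneg fun d _ => hh0 d).trans hhsum
  have hg0 : ∀ q : ℕ, q.Prime → 0 ≤ 𝒜.density q := fun q hq => (hdim.1 q hq).1
  have hgsf : ∀ d : ℕ, Squarefree d → 0 ≤ 𝒜.density d := fun d hd =>
    𝒜.density_mult.nonneg_of_squarefree hg0 hd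
  have hG : ∑ d ∈ Sx, 𝒜.density d ≤ K * Real.log x :=
    sum_squarefree_density_le_log 𝒜.density_mult hdim hx
  have hW0 : 0 ≤ W := junkW_nonneg A₁ 𝒜 x hg0
  have hWle : W ≤ (3 + |A₁| * K) * Real.log x := junkW_le A₁ 𝒜 hdim hx
  /- (i) `Σ_p Σ_{d' copr} h_{pd'} ≤ 2 log x · R` -/
  have hI : ∑ p ∈ P', ∑ d ∈ ((Finset.Icc 1 ⌊x ^ (1 - η) / (p : ℝ)⌋₊).filter Squarefree).filter (fun d => p.Coprime d), h (p * d) ≤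
      2 * Real.log x * R := by
    have step1 : ∀ p ∈ P', ∑ d ∈ ((Finset.Icc 1 ⌊x ^ (1 - η) / (p : ℝ)⌋₊).filter Squarefree).filter (fun d => p.Coprime d), h (p * d) ≤
        ∑ d ∈ S.filter (p ∣ ·), h d := by
      intro p hp
      obtain ⟨hpprime, -, -, -⟩ := hP'mem p hp
      have hp0 : 0 < p := hpprime.pos
      refine FriedlanderIwaniecPrimes.sum_le_sum_of_injOn_real (fun d => p * d) ?_ ?_ (fun d _ => hh0 d)
        (fun d _ => le_rfl)
      · intro d₁ _ d₂ _ he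
        exact Nat.eq_of_mul_eq_mul_left hp0 he
      · intro d hd
        obtain ⟨hd1, hcop⟩ := Finset.mem_filter.mp hd
        obtain ⟨hdI, hsq⟩ := Finset.mem_filter.mp hd1
        obtain ⟨hd1', hdle⟩ := Finset.mem_Icc.mp hdI
        refine Finset.mem_filter.mpr
          ⟨Finset.mem_filter.mpr ⟨Finset.mem_Icc.mpr ⟨Nat.mul_pos hp0 hd1', ?_⟩, ?_⟩, dvd_mul_right p d⟩
        · rw [Nat.floor_div_natCast] at hdle
          rw [mul_comm]
          exact (Nat.le_div_iff_mul_le hp0).mp hdle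
        · exact Nat.squarefree_mul_iff.mpr ⟨hcop, hpprime.prime.squarefree, hsq⟩
    calc ∑ p ∈ P', ∑ d ∈ ((Finset.Icc 1 ⌊x ^ (1 - η) / (p : ℝ)⌋₊).filter Squarefree).filter (fun d => p.Coprime d), h (p * d)
        ≤ ∑ p ∈ P', ∑ d ∈ S.filter (p ∣ ·), h d := Finset.sum_le_sum step1
      _ = ∑ d ∈ S, ∑ p ∈ P'.filter (· ∣ d), h d := by
          simp only [Finset.sum_filter]
          exact Finset.sum_comm
      _ = ∑ d ∈ S, ((P'.filter (· ∣ d)).card : ℝ) * h d := by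
          refine Finset.sum_congr rfl fun d _ => ?_
          rw [Finset.sum_const, nsmul_eq_mul]
      _ ≤ ∑ d ∈ S, 2 * Real.log x * h d := by
          refine Finset.sum_le_sum fun d hd => mul_le_mul_of_nonneg_right ?_ (hh0 d)
          obtain ⟨hdI, -⟩ := Finset.mem_filter.mp hd
          obtain ⟨hd1, hdD⟩ := Finset.mem_Icc.mp hdI
          have hd0 : d ≠ 0 := by omega
          have hdx : (d : ℝ) ≤ x :=
            (show (d : ℝ) ≤ (⌊x ^ (1 - η)⌋₊ : ℝ) by exact_mod_cast hdD).trans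
              ((Nat.floor_le hD0.le).trans hDx)
          calc ((P'.filter (· ∣ d)).card : ℝ) ≤ Real.log d / Real.log 2 :=
                card_filter_dvd_le_log (fun p hp => (hP'mem p hp).1) hd0
            _ ≤ Real.log x / Real.log 2 :=
                div_le_div_of_nonneg_right (Real.log_le_log (by positivity) hdx) hlog2pos.le
            _ ≤ 2 * Real.log x := by
                rw [div_le_iff₀ hlog2pos]
                nlinarith
      _ = 2 * Real.log x * ∑ d ∈ S, h d := by rw [Finset.mul_sum]
      _ ≤ 2 * Real.log x * R := mul_le_mul_of_nonneg_left hhsum (by positivity)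
  /- (ii) `Σ_p h_p Σ_{d'} g(d') ≤ K log x · R` -/
  have hII : ∑ p ∈ P', h p * ∑ d ∈ ((Finset.Icc 1 ⌊x ^ (1 - η) / (p : ℝ)⌋₊).filter Squarefree).filter (fun d => p.Coprime d), 𝒜.density d ≤
      K * Real.log x * R := by
    have step : ∀ p ∈ P', h p * ∑ d ∈ ((Finset.Icc 1 ⌊x ^ (1 - η) / (p : ℝ)⌋₊).filter Squarefree).filter (fun d => p.Coprime d), 𝒜.density d ≤
        h p * (K * Real.log x) := by
      intro p hp
      refine mul_le_mul_of_nonneg_left ?_ (hh0 p)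
      have hp1 : (1 : ℝ) ≤ p := by exact_mod_cast (hP'mem p hp).1.one_lt.le
      calc ∑ d ∈ ((Finset.Icc 1 ⌊x ^ (1 - η) / (p : ℝ)⌋₊).filter Squarefree).filter (fun d => p.Coprime d), 𝒜.density d
          ≤ ∑ d ∈ Sx, 𝒜.density d := by
            refine Finset.sum_le_sum_of_subset_of_nonneg ?_ fun d hd _ => hgsf d (Finset.mem_filter.mp hd).2
            intro d hd
            obtain ⟨hd1, -⟩ := Finset.mem_filter.mp hd
            obtain ⟨hdI, hsq⟩ := Finset.mem_filter.mp hd1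
            obtain ⟨hd1', hdle⟩ := Finset.mem_Icc.mp hdI
            refine Finset.mem_filter.mpr ⟨Finset.mem_Icc.mpr ⟨hd1', hdle.trans (Nat.floor_le_floor ?_)⟩, hsq⟩
            exact (div_le_self hD0.le hp1).trans hDx
        _ ≤ K * Real.log x := hG
    calc ∑ p ∈ P', h p * ∑ d ∈ ((Finset.Icc 1 ⌊x ^ (1 - η) / (p : ℝ)⌋₊).filter Squarefree).filter (fun d => p.Coprime d), 𝒜.density d
        ≤ ∑ p ∈ P', h p * (K * Real.log x) := Finset.sum_le_sum step
      _ = K * Real.log x * ∑ p ∈ P', h p := by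
          rw [Finset.mul_sum]
          exact Finset.sum_congr rfl fun p _ => mul_comm _ _
      _ ≤ K * Real.log x * ∑ d ∈ S, h d := by
          refine mul_le_mul_of_nonneg_left ?_ (by positivity)
          refine Finset.sum_le_sum_of_subset_of_nonneg (fun p hp => ?_) fun d _ _ => hh0 d
          obtain ⟨hpprime, -, hpx, -⟩ := hP'mem p hp
          refine Finset.mem_filter.mpr ⟨Finset.mem_Icc.mpr ⟨hpprime.one_lt.le, ?_⟩, hpprime.prime.squarefree⟩
          exact Nat.le_floor (hpx.trans hsqrtD)
      _ ≤ K * Real.log x * R := mul_le_mul_of_nonneg_left hhsum (by positivity)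
  /- (iii) junk: `Σ_p (x/p²) W ≤ x W · 2/z` -/
  have hIII : ∑ p ∈ P', x / (p : ℝ) ^ 2 * W ≤ 2 * (3 + |A₁| * K) * Real.log x * (x / z) := by
    have hsum : ∑ p ∈ P', ((p : ℝ) ^ 2)⁻¹ ≤ 2 / z := by
      calc ∑ p ∈ P', ((p : ℝ) ^ 2)⁻¹ ≤ ∑ i ∈ Finset.Ioo ⌊z⌋₊ (⌊x⌋₊ + 1), ((i : ℝ) ^ 2)⁻¹ := by
            refine Finset.sum_le_sum_of_subset_of_nonneg (fun p hp => ?_) fun i _ _ => by positivity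
            obtain ⟨-, hzp, -, hple⟩ := hP'mem p hp
            refine Finset.mem_Ioo.mpr ⟨?_, Nat.lt_succ_of_le hple⟩
            have h' : (⌊z⌋₊ : ℝ) < p := (Nat.floor_le hz0.le).trans_lt hzp
            exact_mod_cast h'
        _ ≤ 2 / ((⌊z⌋₊ : ℝ) + 1) := sum_Ioo_inv_sq_le _ _
        _ ≤ 2 / z := div_le_div_of_nonneg_left zero_le_two hz0 (Nat.lt_floor_add_one z).le
    calc ∑ p ∈ P', x / (p : ℝ) ^ 2 * W
        = x * W * ∑ p ∈ P', ((p : ℝ) ^ 2)⁻¹ := by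
          rw [Finset.mul_sum]
          exact Finset.sum_congr rfl fun p _ => by ring
      _ ≤ x * W * (2 / z) := mul_le_mul_of_nonneg_left hsum (mul_nonneg hx0.le hW0)
      _ ≤ x * ((3 + |A₁| * K) * Real.log x) * (2 / z) :=
          mul_le_mul_of_nonneg_right (mul_le_mul_of_nonneg_left hWle hx0.le) (by positivity)
      _ = 2 * (3 + |A₁| * K) * Real.log x * (x / z) := by ring
  -- assembly
  have e1 : ∑ p ∈ P', (∑ d ∈ ((Finset.Icc 1 ⌊x ^ (1 - η) / (p : ℝ)⌋₊).filter Squarefree).filter (fun d => p.Coprime d), (h (p * d) + 𝒜.density d * h p) + x / (p : ℝ) ^ 2 * W) =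
      ∑ p ∈ P', ∑ d ∈ ((Finset.Icc 1 ⌊x ^ (1 - η) / (p : ℝ)⌋₊).filter Squarefree).filter (fun d => p.Coprime d), h (p * d) +
        ∑ p ∈ P', h p * ∑ d ∈ ((Finset.Icc 1 ⌊x ^ (1 - η) / (p : ℝ)⌋₊).filter Squarefree).filter (fun d => p.Coprime d), 𝒜.density d +
        ∑ p ∈ P', x / (p : ℝ) ^ 2 * W := by
    rw [← Finset.sum_add_distrib, ← Finset.sum_add_distrib]
    refine Finset.sum_congr rfl fun p _ => ?_
    have hc : ∑ d ∈ ((Finset.Icc 1 ⌊x ^ (1 - η) / (p : ℝ)⌋₊).filter Squarefree).filter (fun d => p.Coprime d), 𝒜.density d * h p =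
        h p * ∑ d ∈ ((Finset.Icc 1 ⌊x ^ (1 - η) / (p : ℝ)⌋₊).filter Squarefree).filter (fun d => p.Coprime d), 𝒜.density d := by
      rw [Finset.mul_sum]
      exact Finset.sum_congr rfl fun d _ => mul_comm _ _
    rw [Finset.sum_add_distrib, hc]
  rw [e1]
  linarith

end FibreInheritanceAux

open FibreInheritanceAux in
/-- **`stub_fibreInheritance`** (registered stub of skeleton v18, line `section-annihilator`): the fibres
`𝒜_p` (`z < p ≤ x^{1/2}`) of kernel-admissible data are kernel-admissible at `(x/p, η log x/log(x/p), Λ, w₀, R_p)`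
with `Σ_{z < p ≤ x} R_p ≤ C log x (R + x/z)` — weights, support, counting-function size, density, dimension and
Mertens clauses are inherited verbatim; the strong Type-I bound of the fibre is `fibre_strongTypeI`, the sum over
`p` is `sum_fibreBound_le` (`A₃ = 1`, `C = 8 + K + 2|A₁|K`, `K = 4(1 + 2|L'|)`). -/
theorem stub_fibreInheritance : FibreInheritance := by
  intro A₁ L'
  set K : ℝ := 4 * (1 + 2 * |L'|) with hK
  have hK0 : 0 ≤ K := by positivity
  have hAK : 0 ≤ |A₁| * K := mul_nonneg (abs_nonneg _) hK0
  refine ⟨8 + K + 2 * |A₁| * K, 1, by nlinarith, ?_⟩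
  intro 𝒜 x z η Λ w₀ R hx hz hη0 hη2 hR0 hKA
  obtain ⟨ha1, hsuppHi, hsuppLo, hsize, hdens, hdim, hMert, hT⟩ := hKA
  have hx0 : 0 < x := by linarith
  have hg0 : ∀ q : ℕ, q.Prime → 0 ≤ 𝒜.density q := fun q hq => (hdim.1 q hq).1
  -- the majorant of the truncated remainders
  obtain ⟨h, hh0, hhle, hhsum⟩ := exists_truncMajorant 𝒜 hx0.le hsize hT
  refine ⟨fun p => if (p : ℝ) ≤ x ^ (1 / 2 : ℝ) then
      ∑ d ∈ ((Finset.Icc 1 ⌊x ^ (1 - η) / (p : ℝ)⌋₊).filter Squarefree).filter (fun d => p.Coprime d),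
          (h (p * d) + 𝒜.density d * h p) +
        x / (p : ℝ) ^ 2 * ∑ d ∈ (Finset.Icc 1 ⌊x⌋₊).filter Squarefree, (1 / (d : ℝ) + |A₁| * 𝒜.density d)
    else 0, ?_, ?_, ?_⟩
  · intro p
    dsimp only
    split_ifs
    · exact fibreBound_nonneg A₁ 𝒜 x η p h hx0.le hh0 hg0
    · exact le_rfl
  · dsimp only
    rw [← Finset.sum_filter, pow_one]
    refine (sum_fibreBound_le A₁ L' 𝒜 h hx hz hη0.le hη2 hdim hh0 hhsum).trans ?_
    have hL : 0 ≤ Real.log x := Real.log_nonneg (by linarith)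
    have hxz : 0 ≤ x / z := div_nonneg hx0.le (by linarith)
    have h1 : 0 ≤ Real.log x * R := mul_nonneg hL hR0
    have h2 : 0 ≤ Real.log x * (x / z) := mul_nonneg hL hxz
    nlinarith
  · intro p hp hzp hpx
    dsimp only
    rw [if_pos hpx]
    have hp0 : (0 : ℝ) < p := by exact_mod_cast hp.pos
    have hp1 : (1 : ℝ) ≤ p := by exact_mod_cast hp.one_lt.le
    have hxpx : x / p ≤ x := div_le_self hx0.le hp1
    refine ⟨fun q => ha1 (p * q), fun q hq => ?_, fun q hq => ?_, fibreSeq_size 𝒜 p, hdens, hdim,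
      fun w z' hw hwz hz'x => hMert w z' hw hwz (hz'x.trans hxpx),
      fibre_strongTypeI A₁ 𝒜 h hx hη0.le hp hpx ha1 hhle hdens hdim⟩
    · -- support above `x/p`
      change 𝒜.a (p * q) = 0
      refine hsuppHi (p * q) ?_
      rw [div_lt_iff₀ hp0] at hq
      push_cast
      linarith [mul_comm (p : ℝ) q]
    · -- support at or below `(x/p)/Λ`
      change 𝒜.a (p * q) = 0
      refine hsuppLo (p * q) ?_
      rw [div_right_comm, le_div_iff₀ hp0] at hq
      push_cast
      linarith [mul_comm (p : ℝ) q]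

end Summit.Parity.GeneralizedHardyLittlewood.Cruxes.CellParityLaw.SectionAnnihilator

end
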